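import Summits.Ventures.CertifiedQuantumChemistry.Rows.HubbardRingTVDoublonBound
import Literature.MathematicalPhysics.QuantumChemistry.RelaxationRealRestriction
import HarnessLib

/-!
# Ventures/CertifiedQuantumChemistry — Rows/HubbardRingTVDoublonSupergradient.lean: THE DOUBLON READING
# AS A SUPERGRADIENT — on the TV-H files the total doublon weight of an optimal pair is a supergradient
# of `U ↦ OPT_X(L;U)`; hence `OPT_X` is non-decreasing in `U`, optimal doublon weights are non-increasing
# in `U`, and at half filling `0 ≤ OPT_X(U′) − OPT_X(U) ≤ (U′ − U)·16t²L³/U²`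

HONEST FRAMING (verbatim): certified bounds for a stated model Hamiltonian in a stated basis; not a
claim about the real molecule beyond that model. Nothing here is a state, a row, a claim node or a
value of record; the statements are about the optimal values `pqgSectorEnergy` / `pqgSingletEnergy`
(the cell's `DQG` / `DQG+S²` levels) of the cell's Hubbard-ring test-vector tables `hubbardRingTV L t U`
and about ARBITRARY optimal feasible pairs of those programmes; no certified primal point of any file is
asserted to exist or read.

Seat rdm-B (gen 36), zero compute; theorems only (no `def`). `STRUCTURE.md` §2.2.8 (3) "THE DOUBLON
READING (Danskin) — an optimal point of the relaxation carries `⟨D̂⟩ = ∂OPT_X/∂U`" and §2.2.5 /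
`Rows/RelaxationValueConcavity.lean` (gen 21: `OPT_X` is CONCAVE and Lipschitz along every line in table
space) are words resp. a global statement; the elementary pointwise content of Danskin's theorem for a
minimum of affine functions — the derivative of the active affine function is a SUPERGRADIENT of the
value — is typed here on the cell's files, where the `U`-derivative of the functional at a pair is its
total doublon weight `s(Γ) = Σ_p Re Γ_{(p↑,p↓),(p↑,p↓)}` (gen 35's `StrongCouplingDoublon.interaction_eq`).
The EXACT-ENERGY counterpart (Feynman–Hellmann supergradient and Griffiths antitonicity for
`minEnergyOn` along a Hermitian pencil) is already the tree's
`Literature/MathematicalPhysics/QuantumLattice/GriffithsLemmaGroundStates.lean`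
(`minEnergyOn_pencil_le_of_ground`, `re_rayleigh_ground_antitone`); this file is its RELAXATION
analogue — the minimiser is a feasible pair of the `D, Q, G` programme, not a state:

* §1 `hubbardRingTV_rdmEnergy_sub` — for an antisymmetric `Γ`:
  `E_{U′}(γ, Γ) − E_U(γ, Γ) = (U′ − U)·Σ_p d_p` on `hubbardRingTV L t ·` (the one-body table and
  `E_core = 0` do not depend on `U`; the interaction term is `U·Σ_p d_p`); and CLAIM N step (4)'s
  identity `hubbardRingTV_mul_re_rdmEnergy_eq`: `U·Re E_U = U·Re E_{U=0} + U²·s` — the scaled objective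
  is EXACTLY hopping `/ε` plus doublons `/ε²`.
* §2 **THE SUPERGRADIENT INEQUALITY**: if `(γ, Γ)` is feasible for the `(a, b)` sector programme and
  OPTIMAL at `U` (`Re E_U(γ, Γ) = E_PQG^sector(U)`), then for EVERY `U′`:
  `E_PQG^sector(U′) ≤ E_PQG^sector(U) + (U′ − U)·s(Γ)` (`hubbardRingTV_pqgSectorEnergy_le_add_mul_doublon`);
  the singlet level likewise (`hubbardRingTV_pqgSingletEnergy_le_add_mul_doublon`). Read with the
  concavity file: `∂⁺OPT_X(U) ≤ s(Γ*) ≤ ∂⁻OPT_X(U)` — the one-sided difference quotients are typed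
  (`…_slope_le_doublon` / `…_doublon_le_slope`).
* §3 CONSEQUENCES (no half-filling hypothesis): `hubbardRingTV_pqgSectorEnergy_mono` /
  `hubbardRingTV_pqgSingletEnergy_mono` — `U ≤ U′ ⇒ OPT_X(U) ≤ OPT_X(U′)` (doublon weights are
  non-negative; an optimal pair exists at `U′`, `Literature…RelaxationEnergyAttained` /
  `RelaxationRealRestriction`); `hubbardRingTV_optimal_doublon_antitone` — for optimal pairs `Γ` at `U`
  and `Γ′` at `U′ > U`, `s(Γ′) ≤ s(Γ)` (supergradients of a concave function are non-increasing).
* §4 AT HALF FILLING (`a + b = L ≥ 2`, `0 < U ≤ U′`): with gen 35's unconditional bound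
  `s(Γ*) ≤ (4|t|L√L/U)²` for an optimal pair, **`0 ≤ E_PQG^sector(U′) − E_PQG^sector(U) ≤ (U′ − U)·(4|t|L√L/U)²`**
  (`hubbardRingTV_pqgSectorEnergy_sub_mem_Icc`): the value is asymptotically FLAT, with an explicit
  `O(1/U²)` one-sided Lipschitz constant — the quantitative form of "the plateau" on the value side
  (the conjecture leaf's statements about the scaled GAP are untouched).

Everything is PROVED (0 sorry), standard axioms; no definitions, no named facts; no claim node, hint,
row or CERTIFIED cell depends on it. References (docstring-only): J. M. Danskin, *The Theory of
Max-Min* (Springer 1967) ch. I (directional derivatives of a minimum of affine functions);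
R. T. Rockafellar, *Convex Analysis* (1970) §23–§24 (supergradients of concave functions are monotone);
Nakata et al., J. Chem. Phys. 128 (2008) 164113 §II.A (the value as a minimum over a fixed convex set).
-/

noncomputable section

namespace Summit.Ventures.CertifiedQuantumChemistry

open Matrix Finset
open Literature.MathematicalPhysics.QuantumLattice Literature.MathematicalPhysics.QuantumChemistry
open Summit.Ventures.CertifiedQuantumChemistry.Hamiltonians
open scoped ComplexOrder

namespace StrongCouplingDoublon

variable {L : ℕ}
variable {γ : Matrix (Orb (Fin L)) (Orb (Fin L)) ℂ}
  {Γ : Matrix (Orb (Fin L) × Orb (Fin L)) (Orb (Fin L) × Orb (Fin L)) ℂ}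

/-! ### §1 The functional along the `U`-pencil -/

/-- **`E_{U′}(γ, Γ) − E_U(γ, Γ) = (U′ − U)·Σ_p d_p`** on the TV-H tables, for every antisymmetric `Γ`
(any `γ`): the hopping table and `E_core = 0` are `U`-independent and the interaction term is
`U·Σ_p Γ_{(p↑,p↓),(p↑,p↓)}` (`interaction_eq`). [folklore] -/
theorem hubbardRingTV_rdmEnergy_sub (t U U' : ℚ) (hfst : ∀ i j q, Γ (j, i) q = -Γ (i, j) q)
    (hsnd : ∀ r k l, Γ r (l, k) = -Γ r (k, l)) :
    rdmEnergy (fun p q => ((hubbardRingTV L t U').h p q : ℂ))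
        (fun p q r s => ((hubbardRingTV L t U').eri p q r s : ℂ))
        ((hubbardRingTV L t U').ecore : ℂ) γ Γ -
      rdmEnergy (fun p q => ((hubbardRingTV L t U).h p q : ℂ))
        (fun p q r s => ((hubbardRingTV L t U).eri p q r s : ℂ))
        ((hubbardRingTV L t U).ecore : ℂ) γ Γ
      = (((U' : ℝ) : ℂ) - ((U : ℝ) : ℂ)) * ∑ p : Fin L, Γ (orb p 0, orb p 1) (orb p 0, orb p 1) := by
  have hA : ∑ p : Fin L, ∑ q : Fin L, ((hubbardRingTV L t U').h p q : ℂ) * ∑ σ : Fin 2, γ (orb p σ) (orb q σ)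
      = ∑ p : Fin L, ∑ q : Fin L, ((hubbardRingTV L t U).h p q : ℂ) * ∑ σ : Fin 2, γ (orb p σ) (orb q σ) :=
    rfl
  have hB' : (1 / 2 : ℂ) * ∑ p : Fin L, ∑ q : Fin L, ∑ r : Fin L, ∑ s : Fin L,
      ((hubbardRingTV L t U').eri p q r s : ℂ) *
        ∑ σ : Fin 2, ∑ τ : Fin 2, Γ (orb p σ, orb r τ) (orb q σ, orb s τ)
      = (((U' : ℝ) : ℝ) : ℂ) * ∑ p : Fin L, Γ (orb p 0, orb p 1) (orb p 0, orb p 1) :=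
    interaction_eq hfst hsnd _ (hubbardRingTV_eri L t U')
  have hB : (1 / 2 : ℂ) * ∑ p : Fin L, ∑ q : Fin L, ∑ r : Fin L, ∑ s : Fin L,
      ((hubbardRingTV L t U).eri p q r s : ℂ) *
        ∑ σ : Fin 2, ∑ τ : Fin 2, Γ (orb p σ, orb r τ) (orb q σ, orb s τ)
      = (((U : ℝ) : ℝ) : ℂ) * ∑ p : Fin L, Γ (orb p 0, orb p 1) (orb p 0, orb p 1) :=
    interaction_eq hfst hsnd _ (hubbardRingTV_eri L t U)
  have hc' : ((hubbardRingTV L t U').ecore : ℂ) = 0 := by simp [hubbardRingTV]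
  have hc : ((hubbardRingTV L t U).ecore : ℂ) = 0 := by simp [hubbardRingTV]
  rw [rdmEnergy, rdmEnergy, hA, hB', hB, hc', hc]
  ring

/-- The real part: `Re E_{U′}(γ, Γ) = Re E_U(γ, Γ) + (U′ − U)·s(Γ)`, `s(Γ) = Σ_p Re d_p`. [folklore] -/
theorem hubbardRingTV_re_rdmEnergy_eq_add (t U U' : ℚ) (hfst : ∀ i j q, Γ (j, i) q = -Γ (i, j) q)
    (hsnd : ∀ r k l, Γ r (l, k) = -Γ r (k, l)) :
    (rdmEnergy (fun p q => ((hubbardRingTV L t U').h p q : ℂ))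
        (fun p q r s => ((hubbardRingTV L t U').eri p q r s : ℂ))
        ((hubbardRingTV L t U').ecore : ℂ) γ Γ).re
      = (rdmEnergy (fun p q => ((hubbardRingTV L t U).h p q : ℂ))
          (fun p q r s => ((hubbardRingTV L t U).eri p q r s : ℂ))
          ((hubbardRingTV L t U).ecore : ℂ) γ Γ).re
        + ((U' : ℝ) - U) * ∑ p : Fin L, (Γ (orb p 0, orb p 1) (orb p 0, orb p 1)).re := by
  have h := congrArg Complex.re (hubbardRingTV_rdmEnergy_sub (γ := γ) t U U' hfst hsnd)
  rw [Complex.sub_re, ← Complex.ofReal_sub, Complex.re_ofReal_mul, Complex.re_sum] at h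
  linarith

/-- **CLAIM N STEP (4), THE OBJECTIVE IN SCALED VARIABLES**: `U·Re E_U(γ, Γ) = U·Re E_{U=0}(γ, Γ) + U²·s(Γ)`
— the finite-`U` objective times `U` is EXACTLY the hopping functional of `γ/ε` plus the doublon weight
`/ε²` (`ε = 1/U`), the words' "`U·⟨H⟩ = −2Σ_{bonds,σ} γ/ε + Σ_i d_i/ε²` exactly at every `n`".
[folklore] -/
theorem hubbardRingTV_mul_re_rdmEnergy_eq (t U : ℚ) (hfst : ∀ i j q, Γ (j, i) q = -Γ (i, j) q)
    (hsnd : ∀ r k l, Γ r (l, k) = -Γ r (k, l)) :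
    (U : ℝ) * (rdmEnergy (fun p q => ((hubbardRingTV L t U).h p q : ℂ))
        (fun p q r s => ((hubbardRingTV L t U).eri p q r s : ℂ))
        ((hubbardRingTV L t U).ecore : ℂ) γ Γ).re
      = (U : ℝ) * (rdmEnergy (fun p q => ((hubbardRingTV L t 0).h p q : ℂ))
          (fun p q r s => ((hubbardRingTV L t 0).eri p q r s : ℂ))
          ((hubbardRingTV L t 0).ecore : ℂ) γ Γ).re
        + (U : ℝ) ^ 2 * ∑ p : Fin L, (Γ (orb p 0, orb p 1) (orb p 0, orb p 1)).re := by
  rw [hubbardRingTV_re_rdmEnergy_eq_add t 0 U hfst hsnd, Rat.cast_zero, sub_zero]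
  ring

/-! ### §2 The supergradient inequality at an optimal pair -/

/-- **DANSKIN, SECTOR LEVEL.** If `(γ, Γ)` is feasible for the `(a, b)` sector programme of
`hubbardRingTV L t U` and OPTIMAL there (`Re E_U(γ, Γ) = E_PQG^sector(U; a, b)`), then its total doublon
weight is a SUPERGRADIENT of the value at `U`: for every `U′`,
`E_PQG^sector(U′) ≤ E_PQG^sector(U) + (U′ − U)·Σ_p Re d_p` (the same pair is feasible at `U′` — the
feasible set does not depend on `U` — and the value is below the functional there). [folklore] -/
theorem hubbardRingTV_pqgSectorEnergy_le_add_mul_doublon (t U U' : ℚ) {a b : ℕ}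
    (hf : IsDQGFeasibleSector a b γ Γ)
    (hopt : (rdmEnergy (fun p q => ((hubbardRingTV L t U).h p q : ℂ))
        (fun p q r s => ((hubbardRingTV L t U).eri p q r s : ℂ))
        ((hubbardRingTV L t U).ecore : ℂ) γ Γ).re
      = pqgSectorEnergy (fun p q => ((hubbardRingTV L t U).h p q : ℂ))
        (fun p q r s => ((hubbardRingTV L t U).eri p q r s : ℂ))
        ((hubbardRingTV L t U).ecore : ℂ) a b) :
    pqgSectorEnergy (fun p q => ((hubbardRingTV L t U').h p q : ℂ))
        (fun p q r s => ((hubbardRingTV L t U').eri p q r s : ℂ))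
        ((hubbardRingTV L t U').ecore : ℂ) a b
      ≤ pqgSectorEnergy (fun p q => ((hubbardRingTV L t U).h p q : ℂ))
          (fun p q r s => ((hubbardRingTV L t U).eri p q r s : ℂ))
          ((hubbardRingTV L t U).ecore : ℂ) a b
        + ((U' : ℝ) - U) * ∑ p : Fin L, (Γ (orb p 0, orb p 1) (orb p 0, orb p 1)).re := by
  rw [← hopt, ← hubbardRingTV_re_rdmEnergy_eq_add t U U' hf.dqg.swap_fst hf.dqg.swap_snd]
  exact pqgSectorEnergy_le_rdmEnergy _ _ _ hf

/-- **DANSKIN, SINGLET LEVEL**: the same for the singlet-restricted programme (`IsDQGFeasibleSinglet n`,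
value `pqgSingletEnergy`): `E_PQG^singlet(U′) ≤ E_PQG^singlet(U) + (U′ − U)·Σ_p Re d_p` at a pair
optimal at `U`. [folklore] -/
theorem hubbardRingTV_pqgSingletEnergy_le_add_mul_doublon (t U U' : ℚ) {n : ℕ}
    (hf : IsDQGFeasibleSinglet n γ Γ)
    (hopt : (rdmEnergy (fun p q => ((hubbardRingTV L t U).h p q : ℂ))
        (fun p q r s => ((hubbardRingTV L t U).eri p q r s : ℂ))
        ((hubbardRingTV L t U).ecore : ℂ) γ Γ).re
      = pqgSingletEnergy (fun p q => ((hubbardRingTV L t U).h p q : ℂ))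
        (fun p q r s => ((hubbardRingTV L t U).eri p q r s : ℂ))
        ((hubbardRingTV L t U).ecore : ℂ) n) :
    pqgSingletEnergy (fun p q => ((hubbardRingTV L t U').h p q : ℂ))
        (fun p q r s => ((hubbardRingTV L t U').eri p q r s : ℂ))
        ((hubbardRingTV L t U').ecore : ℂ) n
      ≤ pqgSingletEnergy (fun p q => ((hubbardRingTV L t U).h p q : ℂ))
          (fun p q r s => ((hubbardRingTV L t U).eri p q r s : ℂ))
          ((hubbardRingTV L t U).ecore : ℂ) n
        + ((U' : ℝ) - U) * ∑ p : Fin L, (Γ (orb p 0, orb p 1) (orb p 0, orb p 1)).re := by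
  rw [← hopt, ← hubbardRingTV_re_rdmEnergy_eq_add t U U' hf.dqg.swap_fst hf.dqg.swap_snd]
  exact pqgSingletEnergy_le_rdmEnergy _ _ _ hf

/-- **THE RIGHT DIFFERENCE QUOTIENT IS BELOW THE DOUBLON WEIGHT** (`U < U′`):
`(E_PQG(U′) − E_PQG(U))/(U′ − U) ≤ Σ_p Re d_p` at a pair optimal at `U` — `∂⁺OPT(U) ≤ s(Γ*)`.
[folklore] -/
theorem hubbardRingTV_pqgSectorEnergy_slope_le_doublon (t : ℚ) {U U' : ℚ} (hUU' : U < U') {a b : ℕ}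
    (hf : IsDQGFeasibleSector a b γ Γ)
    (hopt : (rdmEnergy (fun p q => ((hubbardRingTV L t U).h p q : ℂ))
        (fun p q r s => ((hubbardRingTV L t U).eri p q r s : ℂ))
        ((hubbardRingTV L t U).ecore : ℂ) γ Γ).re
      = pqgSectorEnergy (fun p q => ((hubbardRingTV L t U).h p q : ℂ))
        (fun p q r s => ((hubbardRingTV L t U).eri p q r s : ℂ))
        ((hubbardRingTV L t U).ecore : ℂ) a b) :
    (pqgSectorEnergy (fun p q => ((hubbardRingTV L t U').h p q : ℂ))
          (fun p q r s => ((hubbardRingTV L t U').eri p q r s : ℂ))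
          ((hubbardRingTV L t U').ecore : ℂ) a b
        - pqgSectorEnergy (fun p q => ((hubbardRingTV L t U).h p q : ℂ))
          (fun p q r s => ((hubbardRingTV L t U).eri p q r s : ℂ))
          ((hubbardRingTV L t U).ecore : ℂ) a b) / ((U' : ℝ) - U)
      ≤ ∑ p : Fin L, (Γ (orb p 0, orb p 1) (orb p 0, orb p 1)).re := by
  have hpos : (0 : ℝ) < (U' : ℝ) - U := by
    have : ((U : ℚ) : ℝ) < U' := by exact_mod_cast hUU'
    linarith
  rw [div_le_iff₀ hpos]
  have h := hubbardRingTV_pqgSectorEnergy_le_add_mul_doublon t U U' hf hopt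
  linarith [mul_comm (((U' : ℝ) - U)) (∑ p : Fin L, (Γ (orb p 0, orb p 1) (orb p 0, orb p 1)).re)]

/-- **THE LEFT DIFFERENCE QUOTIENT IS ABOVE THE DOUBLON WEIGHT** (`U″ < U`):
`Σ_p Re d_p ≤ (E_PQG(U) − E_PQG(U″))/(U − U″)` at a pair optimal at `U` — `s(Γ*) ≤ ∂⁻OPT(U)`.
[folklore] -/
theorem hubbardRingTV_doublon_le_pqgSectorEnergy_slope (t : ℚ) {U'' U : ℚ} (hUU : U'' < U) {a b : ℕ}
    (hf : IsDQGFeasibleSector a b γ Γ)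
    (hopt : (rdmEnergy (fun p q => ((hubbardRingTV L t U).h p q : ℂ))
        (fun p q r s => ((hubbardRingTV L t U).eri p q r s : ℂ))
        ((hubbardRingTV L t U).ecore : ℂ) γ Γ).re
      = pqgSectorEnergy (fun p q => ((hubbardRingTV L t U).h p q : ℂ))
        (fun p q r s => ((hubbardRingTV L t U).eri p q r s : ℂ))
        ((hubbardRingTV L t U).ecore : ℂ) a b) :
    ∑ p : Fin L, (Γ (orb p 0, orb p 1) (orb p 0, orb p 1)).re ≤
      (pqgSectorEnergy (fun p q => ((hubbardRingTV L t U).h p q : ℂ))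
          (fun p q r s => ((hubbardRingTV L t U).eri p q r s : ℂ))
          ((hubbardRingTV L t U).ecore : ℂ) a b
        - pqgSectorEnergy (fun p q => ((hubbardRingTV L t U'').h p q : ℂ))
          (fun p q r s => ((hubbardRingTV L t U'').eri p q r s : ℂ))
          ((hubbardRingTV L t U'').ecore : ℂ) a b) / ((U : ℝ) - U'') := by
  have hpos : (0 : ℝ) < (U : ℝ) - U'' := by
    have : ((U'' : ℚ) : ℝ) < U := by exact_mod_cast hUU
    linarith
  rw [le_div_iff₀ hpos]
  have h := hubbardRingTV_pqgSectorEnergy_le_add_mul_doublon t U U'' hf hopt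
  nlinarith

/-! ### §3 Consequences: the value is non-decreasing in `U`; optimal doublon weights are non-increasing -/

/-- **`U ↦ E_PQG^sector(U; a, b)` IS NON-DECREASING** on `hubbardRingTV L t ·` (`a, b ≤ L`): at an
optimal pair for `U′` the supergradient inequality towards `U ≤ U′` subtracts a non-negative multiple of
a non-negative doublon weight. [folklore] -/
theorem hubbardRingTV_pqgSectorEnergy_mono (t : ℚ) {U U' : ℚ} (hUU' : U ≤ U') {a b : ℕ} (ha : a ≤ L)
    (hb : b ≤ L) :
    pqgSectorEnergy (fun p q => ((hubbardRingTV L t U).h p q : ℂ))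
        (fun p q r s => ((hubbardRingTV L t U).eri p q r s : ℂ))
        ((hubbardRingTV L t U).ecore : ℂ) a b
      ≤ pqgSectorEnergy (fun p q => ((hubbardRingTV L t U').h p q : ℂ))
          (fun p q r s => ((hubbardRingTV L t U').eri p q r s : ℂ))
          ((hubbardRingTV L t U').ecore : ℂ) a b := by
  have ha' : a ≤ Fintype.card (Fin L) := by rw [Fintype.card_fin]; exact ha
  have hb' : b ≤ Fintype.card (Fin L) := by rw [Fintype.card_fin]; exact hb
  obtain ⟨γ', Γ', hf', hE'⟩ := exists_isDQGFeasibleSector_rdmEnergy_eq_pqgSectorEnergy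
    (fun p q => ((hubbardRingTV L t U').h p q : ℂ))
    (fun p q r s => ((hubbardRingTV L t U').eri p q r s : ℂ)) ((hubbardRingTV L t U').ecore : ℂ)
    ha' hb'
  have h := hubbardRingTV_pqgSectorEnergy_le_add_mul_doublon t U' U hf' hE'
  have hs : 0 ≤ ∑ p : Fin L, (Γ' (orb p 0, orb p 1) (orb p 0, orb p 1)).re :=
    sum_nonneg fun p _ =>
      (Complex.nonneg_iff.1 (hf'.dqg.d_psd.diag_nonneg (i := (orb p 0, orb p 1)))).1
  have hd : (U : ℝ) - U' ≤ 0 := by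
    have : ((U : ℚ) : ℝ) ≤ U' := by exact_mod_cast hUU'
    linarith
  have hprod : ((U : ℝ) - U') * ∑ p : Fin L, (Γ' (orb p 0, orb p 1) (orb p 0, orb p 1)).re ≤ 0 :=
    mul_nonpos_iff.2 (Or.inr ⟨hd, hs⟩)
  linarith

/-- **`U ↦ E_PQG^singlet(U; 2n, S = 0)` IS NON-DECREASING** likewise (`n ≤ L`). [folklore] -/
theorem hubbardRingTV_pqgSingletEnergy_mono (t : ℚ) {U U' : ℚ} (hUU' : U ≤ U') {n : ℕ} (hn : n ≤ L) :
    pqgSingletEnergy (fun p q => ((hubbardRingTV L t U).h p q : ℂ))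
        (fun p q r s => ((hubbardRingTV L t U).eri p q r s : ℂ))
        ((hubbardRingTV L t U).ecore : ℂ) n
      ≤ pqgSingletEnergy (fun p q => ((hubbardRingTV L t U').h p q : ℂ))
          (fun p q r s => ((hubbardRingTV L t U').eri p q r s : ℂ))
          ((hubbardRingTV L t U').ecore : ℂ) n := by
  have hn' : n ≤ Fintype.card (Fin L) := by rw [Fintype.card_fin]; exact hn
  obtain ⟨γ', Γ', hf', hE'⟩ := exists_isDQGFeasibleSinglet_rdmEnergy_eq_pqgSingletEnergy
    (fun p q => ((hubbardRingTV L t U').h p q : ℂ))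
    (fun p q r s => ((hubbardRingTV L t U').eri p q r s : ℂ)) ((hubbardRingTV L t U').ecore : ℂ)
    hn'
  have h := hubbardRingTV_pqgSingletEnergy_le_add_mul_doublon t U' U hf' hE'
  have hs : 0 ≤ ∑ p : Fin L, (Γ' (orb p 0, orb p 1) (orb p 0, orb p 1)).re :=
    sum_nonneg fun p _ =>
      (Complex.nonneg_iff.1 (hf'.dqg.d_psd.diag_nonneg (i := (orb p 0, orb p 1)))).1
  have hd : (U : ℝ) - U' ≤ 0 := by
    have : ((U : ℚ) : ℝ) ≤ U' := by exact_mod_cast hUU'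
    linarith
  have hprod : ((U : ℝ) - U') * ∑ p : Fin L, (Γ' (orb p 0, orb p 1) (orb p 0, orb p 1)).re ≤ 0 :=
    mul_nonpos_iff.2 (Or.inr ⟨hd, hs⟩)
  linarith

/-- **OPTIMAL DOUBLON WEIGHTS ARE NON-INCREASING IN `U`**: if `Γ` is (part of) an optimal pair of the
sector programme at `U` and `Γ′` one at `U′ > U`, then `s(Γ′) ≤ s(Γ)` — add the two supergradient
inequalities (supergradients of a concave function are monotone). [folklore] -/
theorem hubbardRingTV_optimal_doublon_antitone (t : ℚ) {U U' : ℚ} (hUU' : U < U') {a b : ℕ}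
    (hf : IsDQGFeasibleSector a b γ Γ)
    (hopt : (rdmEnergy (fun p q => ((hubbardRingTV L t U).h p q : ℂ))
        (fun p q r s => ((hubbardRingTV L t U).eri p q r s : ℂ))
        ((hubbardRingTV L t U).ecore : ℂ) γ Γ).re
      = pqgSectorEnergy (fun p q => ((hubbardRingTV L t U).h p q : ℂ))
        (fun p q r s => ((hubbardRingTV L t U).eri p q r s : ℂ))
        ((hubbardRingTV L t U).ecore : ℂ) a b)
    {γ' : Matrix (Orb (Fin L)) (Orb (Fin L)) ℂ}
    {Γ' : Matrix (Orb (Fin L) × Orb (Fin L)) (Orb (Fin L) × Orb (Fin L)) ℂ}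
    (hf' : IsDQGFeasibleSector a b γ' Γ')
    (hopt' : (rdmEnergy (fun p q => ((hubbardRingTV L t U').h p q : ℂ))
        (fun p q r s => ((hubbardRingTV L t U').eri p q r s : ℂ))
        ((hubbardRingTV L t U').ecore : ℂ) γ' Γ').re
      = pqgSectorEnergy (fun p q => ((hubbardRingTV L t U').h p q : ℂ))
        (fun p q r s => ((hubbardRingTV L t U').eri p q r s : ℂ))
        ((hubbardRingTV L t U').ecore : ℂ) a b) :
    ∑ p : Fin L, (Γ' (orb p 0, orb p 1) (orb p 0, orb p 1)).re ≤
      ∑ p : Fin L, (Γ (orb p 0, orb p 1) (orb p 0, orb p 1)).re := by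
  have h1 := hubbardRingTV_pqgSectorEnergy_le_add_mul_doublon t U U' hf hopt
  have h2 := hubbardRingTV_pqgSectorEnergy_le_add_mul_doublon t U' U hf' hopt'
  have hpos : (0 : ℝ) < (U' : ℝ) - U := by
    have : ((U : ℚ) : ℝ) < U' := by exact_mod_cast hUU'
    linarith
  nlinarith

/-! ### §4 At half filling: the value is asymptotically flat -/

/-- **`0 ≤ E_PQG^sector(U′) − E_PQG^sector(U) ≤ (U′ − U)·(4|t|L√L/U)²`** at half filling
`a + b = L ≥ 2`, `0 < U ≤ U′`: monotonicity (§3) and the supergradient inequality at an optimal pair for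
`U`, whose doublon weight is `≤ (4|t|L√L/U)²` UNCONDITIONALLY (gen 35's
`hubbardRingTV_optimal_sum_doublon_le_sq`). The value's one-sided Lipschitz constant in `U` decays like
`16t²L³/U²`. [folklore] -/
theorem hubbardRingTV_pqgSectorEnergy_sub_mem_Icc (hL : 2 ≤ L) (t : ℚ) {U U' : ℚ} (hU : 0 < U)
    (hUU' : U ≤ U') {a b : ℕ} (hN : a + b = L) :
    pqgSectorEnergy (fun p q => ((hubbardRingTV L t U').h p q : ℂ))
          (fun p q r s => ((hubbardRingTV L t U').eri p q r s : ℂ))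
          ((hubbardRingTV L t U').ecore : ℂ) a b
        - pqgSectorEnergy (fun p q => ((hubbardRingTV L t U).h p q : ℂ))
          (fun p q r s => ((hubbardRingTV L t U).eri p q r s : ℂ))
          ((hubbardRingTV L t U).ecore : ℂ) a b
      ∈ Set.Icc (0 : ℝ) (((U' : ℝ) - U) * (4 * |(t : ℝ)| * L * Real.sqrt L / U) ^ 2) := by
  obtain ⟨γ₀, Γ₀, hf₀, hE₀, hs₀⟩ := hubbardRingTV_optimal_sum_doublon_le_sq hL t hU hN
  have hmono := hubbardRingTV_pqgSectorEnergy_mono (L := L) t hUU' (a := a) (b := b) (by omega) (by omega)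
  have hsg := hubbardRingTV_pqgSectorEnergy_le_add_mul_doublon t U U' hf₀ hE₀
  have hd : (0 : ℝ) ≤ (U' : ℝ) - U := by
    have : ((U : ℚ) : ℝ) ≤ U' := by exact_mod_cast hUU'
    linarith
  refine ⟨by linarith, ?_⟩
  have := mul_le_mul_of_nonneg_left hs₀ hd
  linarith

end StrongCouplingDoublon

end Summit.Ventures.CertifiedQuantumChemistry
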